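import Mathlib
import Summits.ResolutionOfSingularities.ResolutionOfSingularities.Theorems.WeightedInvariantLocalWeightedDropNCResSurfGraphDefs

/-!
# `WeightedInvariant.LocalWeightedDrop`: NC-resolution settings for the TOT₂ line — GRAPH SURFACES, part 2: the calculus of the
# permissibility ideal `InOffPlaneIdeal` (the ideal `(x_j : j ∉ {a,b})^c`), its transport under substitution, and the base directions as
# invariance vectors

Crux item stmt-ResolutionOfSingularities-8899 `LocalWeightedDrop` (route `ResolutionOfSingularities/WeightedInvariant`), ENGINE skeleton v32, residuals
`stub_spaceNCRankDrop` / `stub_wildWideApexFourStartsWon` (res-L1-w43-strat-1's line `directrix-cut` v3.1, piece PL = `ApexPlaneExit`, SURFACE sub-case;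
design memo `L/res-L1-w43-stub-4/g5/S-E2-SURF.md`).  [OURS · L1 W4.3 · chain w43 · seat res-L1-w43-stub-4 gen 5; def-free on part 1
(`…NCResSurfGraphDefs`); the surface twin of res-L1-w43-stub-1's `…NCResCurveGraphIdeal` (S-SET 15), proofs transposed from one off-letter to two;
the count game is the programme's own; nothing here is a statement of any manuscript; AI-produced, gate-checked, weaker than expert review.]

* `InOffPlaneIdeal.add/.neg/.sub/.finsetSum/.mul/.mul_left/.pow/.finsetProd/.finsuppProd`, `inOffPlaneIdeal_zero(_right)`, `inOffPlaneIdeal_X_of_ne`,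
  `InOffPlaneIdeal.of_X_pow_mul_base` — `(x_j : j ∉ {a,b})^c` is an ideal filtration, insensitive to powers of the base letters;
* **`InOffPlaneIdeal.subst`** — TRANSPORT: if every off-base component of a substitution family lies in `(y_j : j ∉ {a',b'})`, the substitution
  maps `(x_j : j ∉ {a,b})^c` into `(y_j : j ∉ {a',b'})^c` (the base components are arbitrary);
* `offDeg₂_add_apply`, `apply_base_eq_zero_of_degree_eq`, **`initEval_add_single_base_of_inOffPlaneIdeal`** — the degree-`c` monomials of
  `G ∈ (x_j : j ∉ {a,b})^c` involve neither base letter, so both base directions are invariance vectors of the degree-`c` form of `G`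
  (`T_x S ⊆ Dir` read in graph coordinates).
-/

set_option linter.dupNamespace false -- mandated namespace of this single-conjunct summit

noncomputable section

namespace Summit.ResolutionOfSingularities.ResolutionOfSingularities.Theorems

namespace TameFourTupleDrop

namespace GraphSurf

open MvPowerSeries Literature.AlgebraicGeometry.Resolution

variable {k : Type} [Field k] {m : ℕ}

/-! ## The permissibility ideal is an ideal filtration -/

section Ideal

variable {a b : Fin (m + 1)}

/-- Everything lies in the `0`-th power. -/
theorem inOffPlaneIdeal_zero_right (a b : Fin (m + 1)) (G : MvPowerSeries (Fin (m + 1)) k) : InOffPlaneIdeal a b 0 G :=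
  fun _ _ => Nat.zero_le _

/-- Zero lies in every power. -/
theorem inOffPlaneIdeal_zero (a b : Fin (m + 1)) (c : ℕ) : InOffPlaneIdeal a b c (0 : MvPowerSeries (Fin (m + 1)) k) :=
  fun _ hE => absurd (map_zero _) hE

/-- Closed under addition. -/
theorem InOffPlaneIdeal.add {c : ℕ} {F G : MvPowerSeries (Fin (m + 1)) k} (hF : InOffPlaneIdeal a b c F) (hG : InOffPlaneIdeal a b c G) :
    InOffPlaneIdeal a b c (F + G) := by
  intro E hE
  rw [map_add] at hE
  by_cases hF0 : coeff E F = 0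
  · rw [hF0, zero_add] at hE; exact hG E hE
  · exact hF E hF0

/-- Closed under negation. -/
theorem InOffPlaneIdeal.neg {c : ℕ} {G : MvPowerSeries (Fin (m + 1)) k} (hG : InOffPlaneIdeal a b c G) : InOffPlaneIdeal a b c (-G) :=
  fun E hE => hG E (by rwa [map_neg, neg_ne_zero] at hE)

/-- Closed under subtraction. -/
theorem InOffPlaneIdeal.sub {c : ℕ} {F G : MvPowerSeries (Fin (m + 1)) k} (hF : InOffPlaneIdeal a b c F) (hG : InOffPlaneIdeal a b c G) :
    InOffPlaneIdeal a b c (F - G) := by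
  rw [sub_eq_add_neg]; exact hF.add hG.neg

/-- Closed under finite sums. -/
theorem InOffPlaneIdeal.finsetSum {ι : Type*} {c : ℕ} (s : Finset ι) (f : ι → MvPowerSeries (Fin (m + 1)) k)
    (h : ∀ x ∈ s, InOffPlaneIdeal a b c (f x)) : InOffPlaneIdeal a b c (∑ x ∈ s, f x) := by
  classical
  induction s using Finset.induction_on with
  | empty => rw [Finset.sum_empty]; exact inOffPlaneIdeal_zero a b c
  | insert x s hx ih =>
    rw [Finset.sum_insert hx]
    exact (h x (Finset.mem_insert_self x s)).add (ih fun y hy => h y (Finset.mem_insert_of_mem hy))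

/-- MULTIPLICATIVITY: `(x_j)^p · (x_j)^q ⊆ (x_j)^{p+q}`. -/
theorem InOffPlaneIdeal.mul {p q : ℕ} {F G : MvPowerSeries (Fin (m + 1)) k} (hF : InOffPlaneIdeal a b p F) (hG : InOffPlaneIdeal a b q G) :
    InOffPlaneIdeal a b (p + q) (F * G) := by
  classical
  intro E hE
  rw [coeff_mul] at hE
  obtain ⟨pr, hpr, hne⟩ := Finset.exists_ne_zero_of_sum_ne_zero hE
  have h1 : coeff pr.1 F ≠ 0 := fun h => hne (by rw [h, zero_mul])
  have h2 : coeff pr.2 G ≠ 0 := fun h => hne (by rw [h, mul_zero])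
  have hsum : pr.1 + pr.2 = E := Finset.HasAntidiagonal.mem_antidiagonal.mp hpr
  rw [← hsum, offDeg₂_add]
  exact add_le_add (hF _ h1) (hG _ h2)

/-- Left multiplication by anything keeps the power. -/
theorem InOffPlaneIdeal.mul_left {c : ℕ} {G : MvPowerSeries (Fin (m + 1)) k} (hG : InOffPlaneIdeal a b c G) (U : MvPowerSeries (Fin (m + 1)) k) :
    InOffPlaneIdeal a b c (U * G) := by
  have h := (inOffPlaneIdeal_zero_right a b U).mul hG
  rwa [zero_add] at h

/-- Powers. -/
theorem InOffPlaneIdeal.pow {p : ℕ} {F : MvPowerSeries (Fin (m + 1)) k} (hF : InOffPlaneIdeal a b p F) (n : ℕ) :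
    InOffPlaneIdeal a b (n * p) (F ^ n) := by
  induction n with
  | zero => rw [zero_mul, pow_zero]; exact inOffPlaneIdeal_zero_right a b 1
  | succ n ih => rw [pow_succ, Nat.succ_mul]; exact ih.mul hF

/-- Finite products. -/
theorem InOffPlaneIdeal.finsetProd {ι : Type*} (s : Finset ι) (f : ι → MvPowerSeries (Fin (m + 1)) k) (p : ι → ℕ)
    (h : ∀ x ∈ s, InOffPlaneIdeal a b (p x) (f x)) : InOffPlaneIdeal a b (∑ x ∈ s, p x) (∏ x ∈ s, f x) := by
  classical
  induction s using Finset.induction_on with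
  | empty => rw [Finset.sum_empty, Finset.prod_empty]; exact inOffPlaneIdeal_zero_right a b 1
  | insert x s hx ih =>
    rw [Finset.sum_insert hx, Finset.prod_insert hx]
    exact (h x (Finset.mem_insert_self x s)).mul (ih fun y hy => h y (Finset.mem_insert_of_mem hy))

/-- A letter off the base lies in the first power. -/
theorem inOffPlaneIdeal_X_of_ne {j : Fin (m + 1)} (h : ¬ (j = a ∨ j = b)) : InOffPlaneIdeal a b 1 (X j : MvPowerSeries (Fin (m + 1)) k) := by
  intro E hE
  rw [coeff_X] at hE
  split_ifs at hE with hEj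
  · rw [hEj, offDeg₂_single_of_ne h]
  · exact absurd rfl hE

/-- CANCELLATION OF POWERS OF A BASE LETTER: `x_j^r · G ∈ (x_l)^c ⇒ G ∈ (x_l)^c` for `j ∈ {a, b}`. -/
theorem InOffPlaneIdeal.of_X_pow_mul_base {c r : ℕ} {j : Fin (m + 1)} (hj : j = a ∨ j = b) {G : MvPowerSeries (Fin (m + 1)) k}
    (h : InOffPlaneIdeal a b c (X j ^ r * G)) : InOffPlaneIdeal a b c G := by
  intro E hE
  have h1 : coeff (Finsupp.single j r + E) (X j ^ r * G) ≠ 0 := by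
    rw [X_pow_eq, coeff_add_monomial_mul, one_mul]; exact hE
  have h2 := h _ h1
  rwa [offDeg₂_add, offDeg₂_single_base hj, zero_add] at h2

/-! ## Transport under substitution -/

/-- The `Finsupp.prod` of powers of a family member-wise in `(y_j : j ∉ {a',b'})^{e_j}` lies in `(y_j)^{Σ D_j e_j}`. -/
theorem InOffPlaneIdeal.finsuppProd {n : ℕ} {a' b' : Fin (n + 1)} {σ : Type*} (D : σ →₀ ℕ) (Λ : σ → MvPowerSeries (Fin (n + 1)) k)
    (e : σ → ℕ) (h : ∀ j, InOffPlaneIdeal a' b' (e j) (Λ j)) :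
    InOffPlaneIdeal a' b' (∑ j ∈ D.support, D j * e j) (D.prod fun j n => Λ j ^ n) := by
  unfold Finsupp.prod
  exact InOffPlaneIdeal.finsetProd _ _ _ fun j _ => (h j).pow (D j)

/-- **TRANSPORT UNDER SUBSTITUTION.**  If `S ∈ (x_j : j ∉ {a,b})^c` and every OFF-BASE component `Λ_j` (`j ∉ {a,b}`) of a substitution family lies in
`(y_j : j ∉ {a',b'})` (the base components `Λ_a`, `Λ_b` are arbitrary), then `S(Λ) ∈ (y_j : j ∉ {a',b'})^c`. -/
theorem InOffPlaneIdeal.subst {n : ℕ} {a' b' : Fin (n + 1)} {c : ℕ} {S : MvPowerSeries (Fin (m + 1)) k} (hS : InOffPlaneIdeal a b c S)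
    (Λ : Fin (m + 1) → MvPowerSeries (Fin (n + 1)) k) (hΛ : HasSubst Λ) (hoff : ∀ j, ¬ (j = a ∨ j = b) → InOffPlaneIdeal a' b' 1 (Λ j)) :
    InOffPlaneIdeal a' b' c (subst Λ S) := by
  classical
  intro E hE
  by_contra hlt
  rw [not_le] at hlt
  apply hE
  rw [coeff_subst hΛ S E]
  have hterm : ∀ D : Fin (m + 1) →₀ ℕ, coeff D S • coeff E (D.prod fun j n => Λ j ^ n) = 0 := by
    intro D
    by_cases hD : coeff D S = 0
    · rw [hD, zero_smul]
    · have hc : c ≤ offDeg₂ a b D := hS D hD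
      have hprod : InOffPlaneIdeal a' b' (∑ j ∈ D.support, D j * (if j = a ∨ j = b then 0 else 1)) (D.prod fun j n => Λ j ^ n) :=
        InOffPlaneIdeal.finsuppProd D Λ (fun j => if j = a ∨ j = b then 0 else 1) fun j => by
          by_cases hj : j = a ∨ j = b
          · rw [if_pos hj]; exact inOffPlaneIdeal_zero_right a' b' _
          · rw [if_neg hj]; exact hoff j hj
      have hsum : offDeg₂ a b D ≤ ∑ j ∈ D.support, D j * (if j = a ∨ j = b then 0 else 1) := by
        rw [offDeg₂]
        calc ∑ j ∈ (Finset.univ.erase a).erase b, D j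
            = ∑ j ∈ (Finset.univ.erase a).erase b, D j * (if j = a ∨ j = b then 0 else 1) :=
              Finset.sum_congr rfl fun j hj => by rw [if_neg (mem_offBase_iff.mp hj), mul_one]
          _ ≤ ∑ j ∈ Finset.univ, D j * (if j = a ∨ j = b then 0 else 1) :=
              Finset.sum_le_sum_of_subset_of_nonneg (Finset.subset_univ _) fun _ _ _ => Nat.zero_le _
          _ = ∑ j ∈ D.support, D j * (if j = a ∨ j = b then 0 else 1) := by
              rw [← Finset.sum_subset (Finset.subset_univ D.support)]
              intro j _ hj
              rw [Finsupp.notMem_support_iff.mp hj, zero_mul]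
      have hzero : coeff E (D.prod fun j n => Λ j ^ n) = 0 := by
        by_contra hne
        exact absurd ((hc.trans hsum).trans (hprod E hne)) (not_le.mpr hlt)
      rw [hzero, smul_zero]
  rw [finsum_congr hterm, finsum_zero]

/-! ## The base directions are invariance vectors -/

/-- Off-base degree plus the two base exponents is the total degree. -/
theorem offDeg₂_add_apply (hab : a ≠ b) (E : Fin (m + 1) →₀ ℕ) : offDeg₂ a b E + E b + E a = E.degree := by
  have hb : b ∈ Finset.univ.erase a := Finset.mem_erase.mpr ⟨fun h => hab h.symm, Finset.mem_univ b⟩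
  rw [offDeg₂, Finsupp.degree_eq_sum, Finset.sum_erase_add _ _ hb, Finset.sum_erase_add _ _ (Finset.mem_univ a)]

/-- A monomial of total degree `c` with off-base degree `≥ c` involves neither base letter. -/
theorem apply_base_eq_zero_of_degree_eq (hab : a ≠ b) {E : Fin (m + 1) →₀ ℕ} {c : ℕ} (hdeg : E.degree = c) (hoff : c ≤ offDeg₂ a b E)
    {j : Fin (m + 1)} (hj : j = a ∨ j = b) : E j = 0 := by
  have h := offDeg₂_add_apply hab E
  rcases hj with rfl | rfl <;> omega

/-- **THE BASE DIRECTIONS ARE INVARIANCE VECTORS** of the degree-`c` form of `G ∈ (x_j : j ∉ {a,b})^c`: the degree-`c` monomials of `G` involve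
neither `x_a` nor `x_b` (`T_x S ⊆ Dir` in graph coordinates, where the surface is the base coordinate plane's complement `V(x_j : j ∉ {a,b})`). -/
theorem initEval_add_single_base_of_inOffPlaneIdeal (hab : a ≠ b) {c : ℕ} {G : MvPowerSeries (Fin (m + 1)) k} (hG : InOffPlaneIdeal a b c G)
    {j : Fin (m + 1)} (hj : j = a ∨ j = b) (v : Fin (m + 1) → k) (t : k) :
    CobordantChart.initEval (fun _ : Fin (m + 1) => 1) (v + Pi.single j t) c G =
      CobordantChart.initEval (fun _ : Fin (m + 1) => 1) v c G := by
  unfold CobordantChart.initEval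
  refine finsum_congr fun D => ?_
  split_ifs with hw
  · by_cases hD : coeff D G = 0
    · rw [hD, zero_mul, zero_mul]
    · have hdeg : D.degree = c := by rw [Finsupp.degree_eq_weight_one]; exact hw
      have hDj : D j = 0 := apply_base_eq_zero_of_degree_eq hab hdeg (hG D hD) hj
      congr 1
      refine Finset.prod_congr rfl fun l _ => ?_
      by_cases hl : l = j
      · rw [hl, hDj, pow_zero, pow_zero]
      · rw [Pi.add_apply, Pi.single_eq_of_ne hl, add_zero]
  · rfl

/-- The same with a scalar multiple of a base direction. -/
theorem inv_smul_single_base_of_inOffPlaneIdeal (hab : a ≠ b) {c : ℕ} {G : MvPowerSeries (Fin (m + 1)) k} (hG : InOffPlaneIdeal a b c G)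
    {j : Fin (m + 1)} (hj : j = a ∨ j = b) (t : k) (v : Fin (m + 1) → k) :
    CobordantChart.initEval (fun _ : Fin (m + 1) => 1) (v + t • Pi.single j (1 : k)) c G =
      CobordantChart.initEval (fun _ : Fin (m + 1) => 1) v c G := by
  rw [← Pi.single_smul', smul_eq_mul, mul_one]
  exact initEval_add_single_base_of_inOffPlaneIdeal hab hG hj v t

/-- **THE TANGENT PLANE OF A PERMISSIBLE GRAPH SURFACE LIES IN THE DIRECTRIX**: if the graph shear's pull-back `Φ_S^* g` lies in
`(x_j : j ∉ {a,b})^c` with `c = ord g`, the images of the two base directions under the linear part `M` of the shear (the tangent plane of the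
surface `S`) are invariance vectors of the degree-`c` form of `g` (directrix transport `inv_subst_legal`, S-SET part 13). -/
theorem base_inv (hab : a ≠ b) {ψ : Fin (m + 1) → MvPowerSeries (Fin 2) k} (hψ : ∀ j, ¬ (j = a ∨ j = b) → constantCoeff (ψ j) = 0)
    {g : MvPowerSeries (Fin (m + 1)) k} {c : ℕ} (hgc : g.order = c) (hperm : InOffPlaneIdeal a b c (subst (shear a b ψ) g))
    {j : Fin (m + 1)} (hj : j = a ∨ j = b) (t : k) (v : Fin (m + 1) → k) :
    CobordantChart.initEval (fun _ : Fin (m + 1) => 1)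
        (v + (Matrix.of fun i l : Fin (m + 1) => coeff (Finsupp.single l 1) (shear a b ψ i)).mulVec (Pi.single j t)) c g =
      CobordantChart.initEval (fun _ : Fin (m + 1) => 1) v c g :=
  inv_subst_legal (shear a b ψ) (constantCoeff_shear hψ) (isUnit_det_linMat_shear hψ) g hgc
    (fun v' => initEval_add_single_base_of_inOffPlaneIdeal hab hperm hj v' t) v

end Ideal

end GraphSurf

end TameFourTupleDrop

end Summit.ResolutionOfSingularities.ResolutionOfSingularities.Theorems

end
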